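import Literature.Probability.Percolation.SharpnessDCTProofs
import HarnessLib

/-!
# Crux `PercNonProliferation.NonProliferation` (stmt-CriticalPhenomena-4444),
# line `avoidance-cost-covering` — stub `stub_disjointShellsIndep`

Helper file for the lead's skeleton of line `avoidance-cost-covering`
(`Cruxes/NonProliferation/Lines/avoidance_cost_covering.lean`). Proves exactly the registered
stub signature `stub_disjointShellsIndep`; lands with `--supports stmt-CriticalPhenomena-4444`.

The statement: INDEPENDENCE OF THE SHELL MULTI-CROSSER EVENTS OF DISJOINT SHELLS. Write
`Sh(a, b) := {v ∈ B(b) | ∃ l, a ≤ |v l|}` for the closed shell `a ≤ ‖v‖∞ ≤ b` of `ℤ^d` and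
`A := Sh-multi_r(a, b)` for the event "there are `r + 1` points of `B(a)`, each joined INSIDE
`Sh(a, b)` to the inner vertex boundary `∂ⁱⁿB(b)`, pairwise NOT joined inside `Sh(a, b)`";
similarly `B := Sh-multi_r(b', c)`. For `b < b'`,
`P_p(A ∩ B) ≤ P_p(A) · P_p(B)` under `P_p = bondPercolation (zdGraph d) p` (in fact `=`).

Proof (Grimmett 1999, §2.2: cylinder events on disjoint edge sets are independent under the
product measure). Each connection event `{x ⟷ y in S}` is determined by the unordered pairs
inside `S` (`DCT16.determinedBy_openConnIn`), hence so is any event mentioning `ω` only through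
such memberships (`StubDisjointShellsIndep.determinedBy_multiCross`). The first shell lies in
`B(b)`, so `A` is determined by the pairs of `B(b)`; every vertex of the second shell has a
coordinate of modulus `≥ b' > b`, so it lies in `B(c) ∖ B(b)` and `B` is determined by the
pairs of `B(c) ∖ B(b)`. The two finite sets of pairs are disjoint, and
`DCT16.real_inter_of_determinedBy_disjoint` gives `P_p(A ∩ B) = P_p(A) P_p(B)`.
-/

noncomputable section

namespace Summit.CriticalPhenomena.PercolationContinuityZ3.Theorems.NonProliferation

open MeasureTheory
open Literature.Probability.LatticeModels Literature.Probability.Percolation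

namespace StubDisjointShellsIndep

/-- **Pairs of a subset.** If every point of the set `S` lies in the finset `F`, then the
unordered pairs of `S` (Mathlib's `Set.sym2`) are pairs of `F` (Mathlib's `Finset.sym2`). -/
theorem sym2_subset_coe_sym2 {V : Type*} {S : Set V} {F : Finset V} (h : ∀ v ∈ S, v ∈ F) :
    S.sym2 ⊆ (↑F.sym2 : Set (Sym2 V)) := by
  intro z hz
  induction z using Sym2.ind with
  | h u v =>
    rw [Set.mk_mem_sym2_iff] at hz
    rw [Finset.mem_coe, Finset.mk_mem_sym2_iff]
    exact ⟨h u hz.1, h v hz.2⟩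

/-- **Locality of the multi-crosser event.** The event "there are `r + 1` points of `A`, each
joined inside `S` to a point of `B`, pairwise not joined inside `S`" mentions the configuration
only through the connection events `{u ⟷ v in S}`, each determined by the pairs inside `S`
(`DCT16.determinedBy_openConnIn`, Grimmett 1999, §2.2); hence it is determined by any set of
pairs `K ⊇ S.sym2`. -/
theorem determinedBy_multiCross {V : Type*} (r : ℕ) (A B : Finset V) (S : Set V)
    {K : Set (Sym2 V)} (hK : S.sym2 ⊆ K) :
    DeterminedBy {ω : BondConfig V | ∃ x : Fin (r + 1) → V, (∀ i, x i ∈ A) ∧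
        (∀ i, ∃ y ∈ B, ω ∈ openConnIn S (x i) y) ∧
        ∀ i j, i ≠ j → ω ∉ openConnIn S (x i) (x j)} K := by
  rw [determinedBy_iff]
  intro ω ω' h
  have key : ∀ u v, ω ∈ openConnIn S u v ↔ ω' ∈ openConnIn S u v := fun u v =>
    (determinedBy_iff _ _).1 (DCT16.determinedBy_openConnIn S u v hK) ω ω' h
  simp only [Set.mem_setOf_eq, key]

/-- **The outer shell avoids the inner box.** For `b < b'`, a point of `B(c)` with a coordinate
of modulus `≥ b'` lies in `B(c) ∖ B(b)`. -/
theorem mem_sdiff_of_mem_shell {d b b' c : ℕ} (hbb' : b < b') {v : Site d}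
    (hv : v ∈ {v : Site d | v ∈ box d c ∧ ∃ l : Fin d, (b' : ℤ) ≤ |v l|}) :
    v ∈ box d c \ box d b := by
  obtain ⟨hvc, l, hl⟩ := hv
  rw [Finset.mem_sdiff]
  refine ⟨hvc, fun hvb => ?_⟩
  have hb := (mem_box.1 hvb) l
  have hle : |v l| ≤ (b : ℤ) := abs_le.2 ⟨hb.1, hb.2⟩
  omega

/-- **Disjoint supports.** The pairs of `B(b)` and the pairs of `B(c) ∖ B(b)` are disjoint
finite sets of pairs. -/
theorem disjoint_sym2_box_sdiff (d b c : ℕ) :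
    Disjoint (box d b).sym2 (box d c \ box d b).sym2 := by
  rw [Finset.disjoint_left]
  intro z hz hz'
  induction z using Sym2.ind with
  | h u v =>
    rw [Finset.mk_mem_sym2_iff] at hz hz'
    exact (Finset.mem_sdiff.1 hz'.1).2 hz.1

end StubDisjointShellsIndep

/-- **Stub `stub_disjointShellsIndep`** of line `avoidance-cost-covering` (crux
stmt-CriticalPhenomena-4444): for `b < b'` the shell multi-crosser events of the vertex-disjoint
closed shells `Sh(a, b) ⊆ B(b)` and `Sh(b', c) ⊆ B(c) ∖ B(b)` satisfy
`P_p(A ∩ B) ≤ P_p(A) · P_p(B)` (with equality): both are determined by the pairs inside their own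
shell (`StubDisjointShellsIndep.determinedBy_multiCross`), the supports `(B(b)).sym2` and
`(B(c) ∖ B(b)).sym2` are disjoint (`StubDisjointShellsIndep.disjoint_sym2_box_sdiff`), and events
determined by disjoint finite sets of pairs are independent under the product measure
`P_p = bondPercolation (zdGraph d) p` (`DCT16.real_inter_of_determinedBy_disjoint`,
Grimmett 1999, §2.2). -/
theorem stub_disjointShellsIndep :
    ∀ (d r a b b' c : ℕ) (p : unitInterval), b < b' →
    (bondPercolation (zdGraph d) p).real
      ({ω | ∃ x : Fin (r + 1) → Site d, (∀ i, x i ∈ box d a) ∧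
        (∀ i, ∃ y ∈ innerBoundary (zdGraph d) (box d b),
          ω ∈ openConnIn {v : Site d | v ∈ box d b ∧ ∃ l : Fin d, (a : ℤ) ≤ |v l|} (x i) y) ∧
        ∀ i j, i ≠ j → ω ∉ openConnIn {v : Site d | v ∈ box d b ∧ ∃ l : Fin d, (a : ℤ) ≤ |v l|} (x i) (x j)} ∩
      {ω | ∃ x : Fin (r + 1) → Site d, (∀ i, x i ∈ box d b') ∧
        (∀ i, ∃ y ∈ innerBoundary (zdGraph d) (box d c),
          ω ∈ openConnIn {v : Site d | v ∈ box d c ∧ ∃ l : Fin d, (b' : ℤ) ≤ |v l|} (x i) y) ∧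
        ∀ i j, i ≠ j → ω ∉ openConnIn {v : Site d | v ∈ box d c ∧ ∃ l : Fin d, (b' : ℤ) ≤ |v l|} (x i) (x j)}) ≤
    (bondPercolation (zdGraph d) p).real
      {ω | ∃ x : Fin (r + 1) → Site d, (∀ i, x i ∈ box d a) ∧
        (∀ i, ∃ y ∈ innerBoundary (zdGraph d) (box d b),
          ω ∈ openConnIn {v : Site d | v ∈ box d b ∧ ∃ l : Fin d, (a : ℤ) ≤ |v l|} (x i) y) ∧
        ∀ i j, i ≠ j → ω ∉ openConnIn {v : Site d | v ∈ box d b ∧ ∃ l : Fin d, (a : ℤ) ≤ |v l|} (x i) (x j)} *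
    (bondPercolation (zdGraph d) p).real
      {ω | ∃ x : Fin (r + 1) → Site d, (∀ i, x i ∈ box d b') ∧
        (∀ i, ∃ y ∈ innerBoundary (zdGraph d) (box d c),
          ω ∈ openConnIn {v : Site d | v ∈ box d c ∧ ∃ l : Fin d, (b' : ℤ) ≤ |v l|} (x i) y) ∧
        ∀ i j, i ≠ j → ω ∉ openConnIn {v : Site d | v ∈ box d c ∧ ∃ l : Fin d, (b' : ℤ) ≤ |v l|} (x i) (x j)} := by
  intro d r a b b' c p hbb'
  exact (DCT16.real_inter_of_determinedBy_disjoint (zdGraph d) p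
    (StubDisjointShellsIndep.determinedBy_multiCross r (box d a) (innerBoundary (zdGraph d) (box d b))
      {v : Site d | v ∈ box d b ∧ ∃ l : Fin d, (a : ℤ) ≤ |v l|}
      (StubDisjointShellsIndep.sym2_subset_coe_sym2 (F := box d b) fun v hv => hv.1))
    (StubDisjointShellsIndep.determinedBy_multiCross r (box d b') (innerBoundary (zdGraph d) (box d c))
      {v : Site d | v ∈ box d c ∧ ∃ l : Fin d, (b' : ℤ) ≤ |v l|}
      (StubDisjointShellsIndep.sym2_subset_coe_sym2 (F := box d c \ box d b) fun v hv =>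
        StubDisjointShellsIndep.mem_sdiff_of_mem_shell hbb' hv))
    (StubDisjointShellsIndep.disjoint_sym2_box_sdiff d b c)).le

end Summit.CriticalPhenomena.PercolationContinuityZ3.Theorems.NonProliferation

end
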